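import Summits.Ventures.YMGap.RobustBall.TruncatedSplitS
import Summits.Ventures.YMGap.RobustBall.RobustMassGapDoor
import HarnessLib

/-!
# Venture YMGap, track ROBUST-BALL (Y2) — «C-SMOOTH-BALL» (i′), DOOR-AGNOSTIC CORE: ONE SPLIT OF THE MOMENTS OF A SLOT FAMILY UNDER ANY STATE WITH
# EXPONENTIAL COVARIANCE DECAY, AND THE OUTER RADIUS OF A LINK SET ABOUT THE SUPPORT OF THE OBSERVABLE

HONEST FRAMING. WHAT THIS IS: a venture file (cell `pub-ymgap`, track Y2 ROBUST-BALL, seat rb-p1, theorems only).  The door-agnostic form of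
`TruncatedSplitS.abs_moment_split_le_S`: the only input is a probability measure `μ` on `SU(N)` lattice gauge configurations with the
COVARIANCE-DECAY PROPERTY `|cov_μ(f, g)| ≤ C_cov (Σ_{Δg} δg)(Σ_{Δf} δf) e^{−t d(Δf, Δg)}` (`t ≥ 0`) for all bounded measurable local observables with
Frobenius-Lipschitz vectors — the pair door gives it with `C_cov = 8N` (`DirectionalSusceptibilityS.abs_cov_le_of_isLipBound_S`), the star door with
`C_cov = 8N/ρ'` at rate `log(1/ρ')/(D+2)` (`abs_covariance_le_of_starWindowBoundZdR_geometric`):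
* ★ `abs_moment_split_le_of_covDecay` — for slots `X i` (`i ∈ S`; measurable, local on `Δ i`, bounded by `M i`, vectors `δ i`) and a cut `p` whose two
  sides have links `≥ g` apart: `|E∏_T X − E∏_{T∩p}X · E∏_{T∖p}X| ≤ C_cov e^{−tg} ∏_T (M_i + S_i)` for every `T ⊆ S` (the `hsplit` hypothesis of ds-1's
  `Cumulants.abs_ac_le_of_split`);
* `linkSetDist_le_rad` / `rad_le` — the outer radius `R(X) = max_{y∈X} dist(y, Λ)` (a `Finset.sup` over `ℝ≥0`); `norm_sub_le_supDiam` /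
  `supDiam_plaquetteEdges_le_one` — the `ℓ^∞`-diameter of a link set as a `Finset.sup` (plaquettes: `≤ 1`).
Consumed by `TruncatedDecayBall` (decay of the truncated functions of every order).  Nothing continuum / Clay.
-/

noncomputable section

open MeasureTheory Function Finset ProbabilityTheory Real
open scoped NNReal
open Literature.Probability.LatticeModels
open Literature.Probability.LatticeModels.DobrushinMetric
open Literature.MathematicalPhysics.QuantumLattice
open Literature.MathematicalPhysics.QuantumFieldTheory hiding ZdEdge
open Summit.Ventures.YMGap.CouplingResponse (covariance_eq_sub_of_abs_le)

namespace Summit.Ventures.YMGap.RobustBall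

variable {d N : ℕ}

/-! ### The outer radius of a link set about `Λ` -/

/-- Local shorthand: the outer radius `R(X) = max_{y ∈ X} dist(y, Λ)` of a link set about `Λ` (`0` for `X = ∅`). -/
local notation3 (prettyPrint := false) "Rad[" Λ "," X "]" =>
  ((Finset.sup X fun y => (linkSetDist Λ y).toNNReal : ℝ≥0) : ℝ)

/-- `dist(y, Λ) ≤ R(X)` for `y ∈ X`. -/
theorem linkSetDist_le_rad {Λ X : Finset (ZdEdge d)} {y : ZdEdge d} (hy : y ∈ X) : linkSetDist Λ y ≤ Rad[Λ, X] := by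
  have h := Finset.le_sup (f := fun y => (linkSetDist Λ y).toNNReal) hy
  have h' : ((linkSetDist Λ y).toNNReal : ℝ) ≤ Rad[Λ, X] := by exact_mod_cast h
  rwa [Real.coe_toNNReal _ (linkSetDist_nonneg Λ y)] at h'

/-- `R(X) ≤ ρ` as soon as every `dist(y, Λ)`, `y ∈ X`, is `≤ ρ` (`ρ ≥ 0`). -/
theorem rad_le {Λ X : Finset (ZdEdge d)} {ρ : ℝ} (hρ : 0 ≤ ρ) (h : ∀ y ∈ X, linkSetDist Λ y ≤ ρ) : Rad[Λ, X] ≤ ρ := by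
  have h1 : (Finset.sup X fun y => (linkSetDist Λ y).toNNReal) ≤ ρ.toNNReal :=
    Finset.sup_le fun y hy => Real.toNNReal_le_toNNReal (h y hy)
  have h2 : ((Finset.sup X fun y => (linkSetDist Λ y).toNNReal : ℝ≥0) : ℝ) ≤ (ρ.toNNReal : ℝ) := by exact_mod_cast h1
  rwa [Real.coe_toNNReal _ hρ] at h2

/-! ### The `ℓ^∞` diameter of a link set -/

/-- `‖y − z‖_∞ ≤ diam X` for `y, z ∈ X`, with `diam X := max_{y,z∈X} ‖y − z‖_∞` (as a `Finset.sup` over `ℝ≥0`, `0` for `X = ∅`). -/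
theorem norm_sub_le_supDiam {X : Finset (ZdEdge d)} {y z : ZdEdge d} (hy : y ∈ X) (hz : z ∈ X) :
    ‖y.1 - z.1‖ ≤ ((X.sup fun y => X.sup fun z => (‖y.1 - z.1‖).toNNReal : ℝ≥0) : ℝ) := by
  have h1 : (‖y.1 - z.1‖).toNNReal ≤ X.sup fun z => (‖y.1 - z.1‖).toNNReal :=
    Finset.le_sup (s := X) (f := fun z => (‖y.1 - z.1‖).toNNReal) hz
  have h2 : (X.sup fun z => (‖y.1 - z.1‖).toNNReal) ≤ X.sup fun y => X.sup fun z => (‖y.1 - z.1‖).toNNReal :=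
    Finset.le_sup (s := X) (f := fun y => X.sup fun z => (‖y.1 - z.1‖).toNNReal) hy
  have h3 : (((‖y.1 - z.1‖).toNNReal : ℝ≥0) : ℝ) ≤ ((X.sup fun y => X.sup fun z => (‖y.1 - z.1‖).toNNReal : ℝ≥0) : ℝ) := by
    exact_mod_cast h1.trans h2
  rwa [Real.coe_toNNReal _ (norm_nonneg _)] at h3

/-- A plaquette's link set has `ℓ^∞`-diameter `≤ 1`. -/
theorem supDiam_plaquetteEdges_le_one (p : ZdPlaquette d) :
    (((plaquetteEdges p).sup fun y => (plaquetteEdges p).sup fun z => (‖y.1 - z.1‖).toNNReal : ℝ≥0) : ℝ) ≤ 1 := by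
  have h : ((plaquetteEdges p).sup fun y => (plaquetteEdges p).sup fun z => (‖y.1 - z.1‖).toNNReal) ≤ (1 : ℝ).toNNReal :=
    Finset.sup_le fun y hy => Finset.sup_le fun z hz => Real.toNNReal_le_toNNReal (norm_sub_le_one_of_mem_plaquetteEdges hy hz)
  have h' : (((plaquetteEdges p).sup fun y => (plaquetteEdges p).sup fun z => (‖y.1 - z.1‖).toNNReal : ℝ≥0) : ℝ) ≤ ((1 : ℝ).toNNReal : ℝ) := by
    exact_mod_cast h
  rwa [Real.coe_toNNReal _ zero_le_one] at h'

/-! ### One split of the moments under covariance decay -/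

/-- **ONE SPLIT OF THE MOMENTS OF A SLOT FAMILY UNDER COVARIANCE DECAY** (door-agnostic form of `TruncatedSplitS.abs_moment_split_le_S`): a
probability measure `μ` with the covariance-decay property (constant `C_cov`, rate `t`); slots `X i` (`i ∈ S`) measurable, local on `Δ i`, bounded by
`M i`, Frobenius-Lipschitz vectors `δ i`; a cut `p` with the links of the two sides `≥ g` apart: for every `T ⊆ S`,
`|∫ ∏_T X dμ − (∫ ∏_{T.filter p} X dμ)(∫ ∏_{T.filter ¬p} X dμ)| ≤ C_cov e^{−t g} ∏_{i∈T} (M i + Σ_{Δ i} δ i)`. -/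
theorem abs_moment_split_le_of_covDecay {μ : Measure (LGConfig d (Matrix.specialUnitaryGroup (Fin N) ℂ))} [IsProbabilityMeasure μ]
    {Ccov t : ℝ} (hCcov : 0 ≤ Ccov) (ht : 0 ≤ t)
    (hCov : ∀ (f g : LGConfig d (Matrix.specialUnitaryGroup (Fin N) ℂ) → ℝ) (Δf Δg : Finset (ZdEdge d)) (Mf Mg : ℝ) (δf δg : ZdEdge d → ℝ),
      Measurable f → DependsOn f (↑Δf : Set (ZdEdge d)) → (∀ σ, |f σ| ≤ Mf) → IsLipBound suFrobDist f δf →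
      Measurable g → DependsOn g (↑Δg : Set (ZdEdge d)) → (∀ σ, |g σ| ≤ Mg) → IsLipBound suFrobDist g δg →
        |cov[f, g; μ]| ≤ Ccov * (∑ y ∈ Δg, δg y) * (∑ y ∈ Δf, δf y) * exp (-(t * setDistEdges Δf Δg)))
    {S : Finset ℕ} {X : ℕ → LGConfig d (Matrix.specialUnitaryGroup (Fin N) ℂ) → ℝ} {Δ : ℕ → Finset (ZdEdge d)} {M : ℕ → ℝ}
    {δ : ℕ → ZdEdge d → ℝ} (hXm : ∀ i ∈ S, Measurable (X i)) (hXdep : ∀ i ∈ S, DependsOn (X i) (↑(Δ i) : Set (ZdEdge d)))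
    (hXM : ∀ i ∈ S, ∀ σ, |X i σ| ≤ M i) (hXδ : ∀ i ∈ S, IsLipBound suFrobDist (X i) (δ i))
    (p : ℕ → Prop) [DecidablePred p] {g : ℝ}
    (hgap : ∀ i ∈ S, p i → ∀ j ∈ S, ¬p j → ∀ y ∈ Δ i, ∀ y' ∈ Δ j, g ≤ ‖y.1 - y'.1‖) :
    ∀ T ⊆ S, |(∫ σ, ∏ i ∈ T, X i σ ∂μ) - (∫ σ, ∏ i ∈ T.filter p, X i σ ∂μ) * (∫ σ, ∏ i ∈ T.filter (fun i => ¬p i), X i σ ∂μ)| ≤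
      Ccov * exp (-(t * g)) * ∏ i ∈ T, (M i + ∑ y ∈ Δ i, δ i y) := by
  classical
  intro T hTS
  set Tp := T.filter p with hTp
  set Tq := T.filter (fun i => ¬p i) with hTq
  have hTpS : Tp ⊆ S := (Finset.filter_subset _ _).trans hTS
  have hTqS : Tq ⊆ S := (Finset.filter_subset _ _).trans hTS
  set σ₀ : LGConfig d (Matrix.specialUnitaryGroup (Fin N) ℂ) := fun _ => 1 with hσ₀
  have hPm : Measurable fun σ => ∏ i ∈ Tp, X i σ := Finset.measurable_prod _ fun i hi => hXm i (hTpS hi)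
  have hQm : Measurable fun σ => ∏ i ∈ Tq, X i σ := Finset.measurable_prod _ fun i hi => hXm i (hTqS hi)
  have hPdep := dependsOn_prod_slots (T := Tp) fun i hi => hXdep i (hTpS hi)
  have hQdep := dependsOn_prod_slots (T := Tq) fun i hi => hXdep i (hTqS hi)
  have hPM := abs_prod_slots_le (T := Tp) fun i hi => hXM i (hTpS hi)
  have hQM := abs_prod_slots_le (T := Tq) fun i hi => hXM i (hTqS hi)
  obtain ⟨δP, hδP, hδPsum⟩ := exists_isLipBound_prod_slots (fun _ _ => suFrobDist_nonneg _ _) σ₀ (T := Tp)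
    (fun i hi => hXdep i (hTpS hi)) (fun i hi => hXM i (hTpS hi)) fun i hi => hXδ i (hTpS hi)
  obtain ⟨δQ, hδQ, hδQsum⟩ := exists_isLipBound_prod_slots (fun _ _ => suFrobDist_nonneg _ _) σ₀ (T := Tq)
    (fun i hi => hXdep i (hTqS hi)) (fun i hi => hXM i (hTqS hi)) fun i hi => hXδ i (hTqS hi)
  have hMS0 : ∀ i ∈ T, 0 ≤ M i + ∑ y ∈ Δ i, δ i y := fun i hi =>
    add_nonneg ((abs_nonneg _).trans (hXM i (hTS hi) σ₀)) (Finset.sum_nonneg fun y _ => (hXδ i (hTS hi)).nonneg y)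
  have hprod : ∏ i ∈ T, (M i + ∑ y ∈ Δ i, δ i y) = (∏ i ∈ Tp, (M i + ∑ y ∈ Δ i, δ i y)) * ∏ i ∈ Tq, (M i + ∑ y ∈ Δ i, δ i y) :=
    (Finset.prod_filter_mul_prod_filter_not T p _).symm
  have hRHS0 : 0 ≤ Ccov * exp (-(t * g)) * ∏ i ∈ T, (M i + ∑ y ∈ Δ i, δ i y) :=
    mul_nonneg (mul_nonneg hCcov (exp_pos _).le) (Finset.prod_nonneg hMS0)
  have hsplit : (∫ σ, ∏ i ∈ T, X i σ ∂μ) = ∫ σ, (∏ i ∈ Tp, X i σ) * ∏ i ∈ Tq, X i σ ∂μ := by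
    refine integral_congr_ae (ae_of_all _ fun σ => ?_)
    exact (Finset.prod_filter_mul_prod_filter_not T p _).symm
  have hcov : (∫ σ, ∏ i ∈ T, X i σ ∂μ) - (∫ σ, ∏ i ∈ Tp, X i σ ∂μ) * (∫ σ, ∏ i ∈ Tq, X i σ ∂μ) =
      cov[fun σ => ∏ i ∈ Tp, X i σ, fun σ => ∏ i ∈ Tq, X i σ; μ] := by
    rw [hsplit, covariance_eq_sub_of_abs_le hPm hQm hPM hQM]
  rw [hcov]
  by_cases hPne : (Tp.biUnion Δ).Nonempty
  swap
  · have hconst : (fun σ => ∏ i ∈ Tp, X i σ) = fun _ => ∏ i ∈ Tp, X i σ₀ := by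
      funext σ
      rw [Finset.not_nonempty_iff_eq_empty] at hPne
      exact eq_const_of_dependsOn_empty (hPne ▸ hPdep) σ σ₀
    rw [hconst, covariance_const_left]
    simpa only [abs_zero] using hRHS0
  by_cases hQne : (Tq.biUnion Δ).Nonempty
  swap
  · have hconst : (fun σ => ∏ i ∈ Tq, X i σ) = fun _ => ∏ i ∈ Tq, X i σ₀ := by
      funext σ
      rw [Finset.not_nonempty_iff_eq_empty] at hQne
      exact eq_const_of_dependsOn_empty (hQne ▸ hQdep) σ σ₀
    rw [hconst, covariance_const_right]
    simpa only [abs_zero] using hRHS0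
  have hdist : g ≤ setDistEdges (Tp.biUnion Δ) (Tq.biUnion Δ) := by
    obtain ⟨u, hu, w, hw, heq⟩ := exists_setDistEdges_eq hPne hQne
    rw [heq]
    obtain ⟨i, hi, hui⟩ := Finset.mem_biUnion.1 hu
    obtain ⟨j, hj, hwj⟩ := Finset.mem_biUnion.1 hw
    exact hgap i (hTpS hi) (Finset.mem_filter.1 hi).2 j (hTqS hj) (Finset.mem_filter.1 hj).2 u hui w hwj
  have h1 := hCov _ _ _ _ _ _ δP δQ hPm hPdep hPM hδP hQm hQdep hQM hδQ
  have hδP0 : 0 ≤ ∑ y ∈ Tp.biUnion Δ, δP y := Finset.sum_nonneg fun y _ => hδP.nonneg y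
  have hδQ0 : 0 ≤ ∑ y ∈ Tq.biUnion Δ, δQ y := Finset.sum_nonneg fun y _ => hδQ.nonneg y
  have hexp : exp (-(t * setDistEdges (Tp.biUnion Δ) (Tq.biUnion Δ))) ≤ exp (-(t * g)) :=
    exp_le_exp.2 (by nlinarith)
  have hPp0 : 0 ≤ ∏ i ∈ Tp, (M i + ∑ y ∈ Δ i, δ i y) := Finset.prod_nonneg fun i hi => hMS0 i (Finset.filter_subset _ _ hi)
  have hQp0 : 0 ≤ ∏ i ∈ Tq, (M i + ∑ y ∈ Δ i, δ i y) := Finset.prod_nonneg fun i hi => hMS0 i (Finset.filter_subset _ _ hi)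
  calc |cov[fun σ => ∏ i ∈ Tp, X i σ, fun σ => ∏ i ∈ Tq, X i σ; μ]|
      ≤ Ccov * (∑ y ∈ Tq.biUnion Δ, δQ y) * (∑ y ∈ Tp.biUnion Δ, δP y) * exp (-(t * setDistEdges (Tp.biUnion Δ) (Tq.biUnion Δ))) := h1
    _ ≤ Ccov * (∏ i ∈ Tq, (M i + ∑ y ∈ Δ i, δ i y)) * (∏ i ∈ Tp, (M i + ∑ y ∈ Δ i, δ i y)) * exp (-(t * g)) := by
        gcongr
    _ = Ccov * exp (-(t * g)) * ∏ i ∈ T, (M i + ∑ y ∈ Δ i, δ i y) := by rw [hprod]; ring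


end Summit.Ventures.YMGap.RobustBall

end
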